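import Summits.AtomisticToContinuum.HydrodynamicLimit.Theorems.OneFlightGossipEngineUniformLocalGibbsConcentrationPerturb
import Summits.AtomisticToContinuum.HydrodynamicLimit.Theorems.OneFlightGossipEngineUniformLocalGibbsConcentrationTilt

/-!
# Exponential concentration of the density field of the canonical hard-sphere gas at low density

Helper file for the support item `UniformLocalGibbsConcentration` (routes `OneFlightGossipEngine`, `TwoClocks`)
(stmt-AtomisticToContinuum-14445): the LARGE-DEVIATION UPPER BOUND behind the law of large
numbers `localGibbs_densityLLN_holds` of `HardSphereEulerLLN`, with an `η₀`-UNIFORM smallness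
condition. For a density profile `P` on `𝕋³` and `0 < σ < 1/2` with `e · 2M · v₁ · σ³ ≤ 1/32`
(`M = sup β`), the canonical law `ν_N = Ξ⁻¹ μ_P^{⊗(N+1)}|_{hard core}` of `N + 1` spheres of
diameter `σ (N+1)^{-1/3}` satisfies, for every continuous `χ` and `δ > 0`,
`ν_N {δ < |(N+1)⁻¹ ∑ χ(xᵢ) - I(χ)|} ≤ K e^{-(N+1)/K}` for all `N` (`density_concentration`),
`I(χ) = Ilim P σ χ = ∫ χ ρ₀`, `ρ₀ = rhoLim P σ`.

Proof: exponential Chebyshev with the tilted profile (`canonical_tail_le`): the exponent is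
`n t (E_{Q_t}[χ(x₀)] - I - δ)`; `E_{Q_t}[χ(x₀)] = onePt Q_t σ χ N 0 → Ilim Q_t σ χ` by the tree's
one-point cluster limit for the tilted profile (`SmallDensity.tendsto_onePt`), and
`|Ilim Q_t σ χ - Ilim P σ χ| ≤ L · M (e^{2tC} - 1) ≤ δ/3` for `t` small by the profile-Lipschitz
bound `abs_Ilim_sub_le`; finitely many `N` are absorbed in the constant. Also:
`rhoLim_pos_of_geomRatio_le` — `ρ₀ > 0` under the uniform smallness `θ ≤ 1/16` (factor `β(x)` out
of the cluster series), replacing the profile-wise positivity condition of the tree.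
-/

noncomputable section

namespace Summit.AtomisticToContinuum.HydrodynamicLimit.Theorems

namespace UniformLGC

open MeasureTheory Filter Set Topology Finset
open scoped ENNReal
open Literature.MathematicalPhysics.KineticTheory Literature.MathematicalPhysics.StatisticalMechanics

/-! ### Positivity of the limit density, uniformly -/

/-- **`ρ₀ > 0` under the uniform smallness `θ ≤ 1/16`**: `rhoLim P σ x = β(x) (R + tail)` with
`R ≥ 1/2` and `|tail| ≤ 2eθ/(1-θ) < 1/2`. -/
theorem rhoLim_pos_of_geomRatio_le {P : DensityProfile} {σ : ℝ} (h : SmallDensity P σ)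
    (hθ : geomRatio P σ ≤ 1 / 16) (x : T3) : 0 < rhoLim P σ x := by
  have he1 : Real.exp 1 < 2.7182818286 := Real.exp_one_lt_d9
  have he0 : 0 < Real.exp 1 := Real.exp_pos 1
  have hθ0 := h.geomRatio_nonneg
  have hθ1 := h.geomRatio_lt_one
  have hβ := P.pos x
  have hR := h.ratioLimit_mem.1
  have hR2 := h.ratioLimit_mem.2
  have hR0 := h.ratioLimit_pos
  set θ := geomRatio P σ with hθdef
  -- the series with `β(x)` factored out
  set g : ℕ → ℝ := fun j => clusterCoeff σ j * ratioLimit P σ ^ (j + 1) * P.β x ^ j with hg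
  have hterm : ∀ j, |g j| ≤ 2 * Real.exp 1 * θ ^ j := by
    intro j
    have hγ := abs_clusterCoeff_le h.σ_pos h.σ_lt_half j
    have hv := v₁_pos.le
    have hσ3 : 0 ≤ σ ^ 3 := pow_nonneg h.σ_pos.le 3
    rw [hg]; dsimp only
    rw [abs_mul, abs_mul, abs_of_pos (pow_pos hR0 _), abs_of_nonneg (pow_nonneg hβ.le _)]
    calc |clusterCoeff σ j| * ratioLimit P σ ^ (j + 1) * P.β x ^ j
        ≤ (Real.exp 1 * (Real.exp 1 * (v₁ * σ ^ 3)) ^ j) * 2 ^ (j + 1) * P.M ^ j := by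
          gcongr
          exact P.le_M x
      _ = 2 * Real.exp 1 * θ ^ j := by rw [hθdef, geomRatio, ovDensity, pow_succ]; ring
  have hsum : Summable g := Summable.of_norm_bounded
    ((summable_geometric_of_lt_one hθ0 hθ1).mul_left (2 * Real.exp 1))
    fun j => (Real.norm_eq_abs _).trans_le (hterm j)
  have hfac : rhoLim P σ x = P.β x * ∑' j, g j := by
    rw [rhoLim, ← tsum_mul_left]
    exact tsum_congr fun j => by rw [hg]; ring
  have hg0 : g 0 = ratioLimit P σ := by
    have h1 : clusterCoeff σ 0 = 1 := by
      have h1 := coefLim_one_zero (P := P) h.σ_pos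
      rw [coefLim] at h1
      simpa [P.integral_eq_one] using h1
    rw [hg]; simp [h1]
  have hgeo : HasSum (fun j : ℕ => 2 * Real.exp 1 * θ ^ (j + 1)) (2 * Real.exp 1 * θ / (1 - θ)) := by
    have h' := (hasSum_geometric_of_lt_one hθ0 hθ1).mul_left (2 * Real.exp 1 * θ)
    rw [div_eq_mul_inv]
    refine h'.congr_fun fun j => ?_
    rw [pow_succ]; ring
  have htail : |∑' j, g (j + 1)| ≤ 2 * Real.exp 1 * θ / (1 - θ) :=
    (Real.norm_eq_abs _).symm.trans_le (tsum_of_norm_bounded hgeo fun j =>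
      (Real.norm_eq_abs _).trans_le (hterm (j + 1)))
  have hsmall : 2 * Real.exp 1 * θ / (1 - θ) < 1 / 2 := by
    rw [div_lt_iff₀ (by linarith)]; nlinarith
  rw [hfac, hsum.tsum_eq_zero_add, hg0]
  refine mul_pos hβ ?_
  have := neg_abs_le (∑' j, g (j + 1))
  linarith

/-! ### Linearity of the limit functional -/

/-- `Ilim P σ (-χ) = - Ilim P σ χ`. -/
theorem Ilim_neg (P : DensityProfile) (σ : ℝ) (χ : T3 → ℝ) :
    Ilim P σ (fun y => -χ y) = -Ilim P σ χ := by
  rw [Ilim, Ilim, ← tsum_neg]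
  refine tsum_congr fun j => ?_
  rw [coefLim, coefLim]
  have : (∫ y, -χ y * P.β y ^ (j + 1)) = -∫ y, χ y * P.β y ^ (j + 1) := by
    rw [← integral_neg]; exact integral_congr_ae (ae_of_all _ fun y => by ring)
  rw [this]; ring

/-! ### The one-sided bound, eventually in `N` -/

section OneSided

variable {P : DensityProfile} {σ : ℝ}

/-- `e^{1/2} < 2`. -/
theorem exp_half_lt_two : Real.exp (1 / 2) < 2 := by
  have he1 : Real.exp 1 < 2.7182818286 := Real.exp_one_lt_d9
  by_contra hc
  push Not at hc
  have h4 : (2 : ℝ) ^ 2 ≤ Real.exp (1 / 2) ^ 2 := pow_le_pow_left₀ (by norm_num) hc 2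
  rw [← Real.exp_nat_mul] at h4
  norm_num at h4
  linarith

/-- **Upper tail, eventually.** Under the uniform smallness `e · 2M · v₁ · σ³ ≤ 1/32`, for
continuous `|χ| ≤ C` and `δ > 0` there are a rate `r > 0` and `N₀` such that for `N ≥ N₀` the
canonical law of `N + 1` spheres gives `{(N+1)(I + δ) ≤ ∑ χ(xᵢ)}` mass `≤ e^{-r(N+1)}`,
`I = Ilim P σ χ`. -/
theorem eventually_upperTail_le (hσ : 0 < σ) (hσ2 : σ < 1 / 2)
    (hsmall : Real.exp 1 * (2 * P.M * v₁ * σ ^ 3) ≤ 1 / 32) {χ : T3 → ℝ} (hχ : Continuous χ)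
    {C : ℝ} (hC : 0 < C) (hχC : ∀ y, |χ y| ≤ C) {δ : ℝ} (hδ : 0 < δ) :
    ∃ r : ℝ, 0 < r ∧ ∃ N₀ : ℕ, ∀ N : ℕ, N₀ ≤ N →
      (ENNReal.ofReal (Xi P (hsDiameter σ N) (N + 1) (N + 1))⁻¹ •
          (Measure.pi fun _ : Fin (N + 1) => P.μ).restrict (hardCoreSet (Ov (hsDiameter σ N)) univ))
        {x | ((N + 1 : ℕ) : ℝ) * (Ilim P σ χ + δ) ≤ ∑ i, χ (x i)} ≤
      ENNReal.ofReal (Real.exp (-(r * ((N + 1 : ℕ) : ℝ)))) := by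
  set Mstar := 2 * P.M with hMstar
  set η := Real.exp 1 * (Mstar * v₁ * σ ^ 3) with hηdef
  have hη : η ≤ 1 / 32 := by
    rw [hηdef, hMstar]; exact hsmall
  have hM := P.M_pos
  have hMP : P.M ≤ Mstar := by rw [hMstar]; linarith
  have hP : SmallDensity P σ := smallDensity_of_eta_le hσ hσ2 hMP hη
  have he0 : 0 < Real.exp 1 := Real.exp_pos 1
  have hη0 : 0 ≤ η := by have := v₁_pos.le; positivity
  have h2η : 0 < 1 - 2 * η := by linarith
  -- the Lipschitz constant of `Q ↦ Ilim Q σ χ`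
  set L := Real.exp 1 * C * (2 + 4 * (Real.exp 1 / (1 - 2 * η) ^ 2)) / (1 - 2 * η) ^ 2 with hL
  have hL0 : 0 < L := by positivity
  -- the tilt parameter
  set t := min (1 / (4 * C)) (δ / (12 * L * P.M * C)) with ht
  have ht0 : 0 < t := lt_min (by positivity) (by positivity)
  have htC : 2 * t * C ≤ 1 / 2 := by
    have : t ≤ 1 / (4 * C) := min_le_left _ _
    rw [le_div_iff₀ (by positivity)] at this; linarith
  have htδ : 12 * L * P.M * C * t ≤ δ := by
    have : t ≤ δ / (12 * L * P.M * C) := min_le_right _ _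
    rwa [le_div_iff₀ (by positivity), mul_comm] at this
  -- the tilted profile
  obtain ⟨Q, hQ⟩ := exists_tilt P hχ t
  have habs : |t| = t := abs_of_pos ht0
  have hexp2 : Real.exp (2 * |t| * C) ≤ 2 := by
    rw [habs]
    exact ((Real.exp_le_exp.2 htC).trans exp_half_lt_two.le)
  have hMQ : Q.M ≤ Mstar := by
    refine (tilt_M_le hχ hχC hQ).trans ?_
    rw [hMstar]; nlinarith
  have hQs : SmallDensity Q σ := smallDensity_of_eta_le hσ hσ2 hMQ hη
  set ω := P.M * (Real.exp (2 * |t| * C) - 1) with hω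
  have hωβ : ∀ y, |Q.β y - P.β y| ≤ ω := abs_tilt_sub_le hχ hχC hQ
  have hωle : ω ≤ 4 * P.M * t * C := by
    have h1 : |2 * t * C| ≤ 1 := by rw [abs_of_nonneg (by positivity)]; linarith
    have h2 := Real.abs_exp_sub_one_le h1
    rw [abs_of_nonneg (by positivity : (0 : ℝ) ≤ 2 * t * C)] at h2
    have h3 : Real.exp (2 * |t| * C) - 1 ≤ 2 * (2 * t * C) := by rw [habs]; exact (le_abs_self _).trans h2
    rw [hω]; nlinarith
  have hIlim : |Ilim Q σ χ - Ilim P σ χ| ≤ δ / 3 := by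
    have h1 := abs_Ilim_sub_le hP hQs hMP hMQ hη hωβ hχ hχC
    have h2 : Real.exp 1 * C * (2 * ω + 4 * (Real.exp 1 * ω / (1 - 2 * η) ^ 2)) / (1 - 2 * η) ^ 2 = L * ω := by
      rw [hL]; ring
    rw [h2] at h1
    have h3 : L * ω ≤ L * (4 * P.M * t * C) := mul_le_mul_of_nonneg_left hωle hL0.le
    linarith
  -- the one-point limit for the tilted profile
  have hlim := hQs.tendsto_onePt hχ.measurable hχC 0
  rw [Metric.tendsto_atTop] at hlim
  obtain ⟨N₀, hN₀⟩ := hlim (δ / 3) (by positivity)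
  refine ⟨t * δ / 3, by positivity, N₀, fun N hN => ?_⟩
  have hone := hN₀ N hN
  rw [Real.dist_eq] at hone
  have hXiP : 0 < Xi P (hsDiameter σ N) (N + 1) (N + 1) :=
    XiN_pos hσ.le hσ2 hP.ovDensity_lt_one le_rfl
  have htail := canonical_tail_le (hsDiameter σ N) (n := N + 1) hχ hχC hQ ht0 hXiP (Ilim P σ χ + δ)
  refine htail.trans (ENNReal.ofReal_le_ofReal (Real.exp_le_exp.2 ?_))
  have hone' : Md Q (hsDiameter σ N) (N + 1) χ (N + 1) / Xi Q (hsDiameter σ N) (N + 1) (N + 1) =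
      onePt Q σ χ N 0 := by simp [onePt, XiN]
  rw [hone']
  have hn : (0 : ℝ) < ((N + 1 : ℕ) : ℝ) := by positivity
  have key : onePt Q σ χ N 0 - (Ilim P σ χ + δ) ≤ -(δ / 3) := by
    have := abs_lt.1 hone
    have := abs_le.1 hIlim
    linarith [this.2]
  calc ((N + 1 : ℕ) : ℝ) * t * (onePt Q σ χ N 0 - (Ilim P σ χ + δ))
      ≤ ((N + 1 : ℕ) : ℝ) * t * (-(δ / 3)) := mul_le_mul_of_nonneg_left key (by positivity)
    _ = -(t * δ / 3 * ((N + 1 : ℕ) : ℝ)) := by ring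

end OneSided

/-! ### The two-sided bound for all `N` -/

section TwoSided

variable {P : DensityProfile} {σ : ℝ}

/-- The canonical law is a sub-probability: `ν_N(A) ≤ 1`. -/
theorem canonical_le_one (hσ : 0 < σ) (hσ2 : σ < 1 / 2) (hlam : ovDensity P σ < 1) (N : ℕ)
    (A : Set (Fin (N + 1) → T3)) :
    (ENNReal.ofReal (Xi P (hsDiameter σ N) (N + 1) (N + 1))⁻¹ •
        (Measure.pi fun _ : Fin (N + 1) => P.μ).restrict (hardCoreSet (Ov (hsDiameter σ N)) univ)) A ≤ 1 := by
  have hXi : 0 < Xi P (hsDiameter σ N) (N + 1) (N + 1) := XiN_pos hσ.le hσ2 hlam le_rfl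
  set ρ := (Measure.pi fun _ : Fin (N + 1) => P.μ).restrict (hardCoreSet (Ov (hsDiameter σ N)) univ) with hρ
  have huniv : ρ.real univ = Xi P (hsDiameter σ N) (N + 1) (N + 1) := by
    rw [hρ, measureReal_restrict_apply_univ, Xi, firstLabels_self]; rfl
  calc (ENNReal.ofReal (Xi P (hsDiameter σ N) (N + 1) (N + 1))⁻¹ • ρ) A
      ≤ (ENNReal.ofReal (Xi P (hsDiameter σ N) (N + 1) (N + 1))⁻¹ • ρ) univ := measure_mono (subset_univ _)
    _ = 1 := by
        rw [Measure.smul_apply, smul_eq_mul, ← ofReal_measureReal (measure_ne_top ρ _), huniv,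
          ← ENNReal.ofReal_mul (inv_nonneg.2 hXi.le), inv_mul_cancel₀ hXi.ne', ENNReal.ofReal_one]

/-- Packaging two exponential rates and finitely many exceptional `N` into one constant:
if `p N ≤ 1` always and `p N ≤ e^{-r₁(N+1)} + e^{-r₂(N+1)}` for `N ≥ N₀`, then
`p N ≤ K e^{-(N+1)/K}` for all `N` with `K = N₀ + 3 + r₁⁻¹ + r₂⁻¹`. -/
theorem exists_const_of_eventually {p : ℕ → ℝ≥0∞} (hp1 : ∀ N, p N ≤ 1) {r₁ r₂ : ℝ} (hr₁ : 0 < r₁)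
    (hr₂ : 0 < r₂) {N₀ : ℕ} (hev : ∀ N, N₀ ≤ N →
      p N ≤ ENNReal.ofReal (Real.exp (-(r₁ * ((N + 1 : ℕ) : ℝ)))) + ENNReal.ofReal (Real.exp (-(r₂ * ((N + 1 : ℕ) : ℝ))))) :
    ∃ K : ℝ, 0 < K ∧ ∀ N : ℕ, p N ≤ ENNReal.ofReal (K * Real.exp (-(K⁻¹ * ((N : ℝ) + 1)))) := by
  set K : ℝ := (N₀ : ℝ) + 3 + r₁⁻¹ + r₂⁻¹ with hK
  have hr₁' : 0 < r₁⁻¹ := inv_pos.2 hr₁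
  have hr₂' : 0 < r₂⁻¹ := inv_pos.2 hr₂
  have hK3 : 3 ≤ K := by rw [hK]; have := (Nat.cast_nonneg N₀ : (0 : ℝ) ≤ N₀); linarith
  have hK0 : 0 < K := by linarith
  have hKr₁ : K⁻¹ ≤ r₁ := by
    rw [inv_le_comm₀ hK0 hr₁, hK]; have := (Nat.cast_nonneg N₀ : (0 : ℝ) ≤ N₀); linarith
  have hKr₂ : K⁻¹ ≤ r₂ := by
    rw [inv_le_comm₀ hK0 hr₂, hK]; have := (Nat.cast_nonneg N₀ : (0 : ℝ) ≤ N₀); linarith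
  refine ⟨K, hK0, fun N => ?_⟩
  have hn : (0 : ℝ) ≤ (N : ℝ) + 1 := by positivity
  by_cases hN : N₀ ≤ N
  · refine (hev N hN).trans ?_
    rw [← ENNReal.ofReal_add (Real.exp_pos _).le (Real.exp_pos _).le]
    refine ENNReal.ofReal_le_ofReal ?_
    have h1 : Real.exp (-(r₁ * ((N + 1 : ℕ) : ℝ))) ≤ Real.exp (-(K⁻¹ * ((N : ℝ) + 1))) := by
      rw [Real.exp_le_exp]; push_cast; nlinarith
    have h2 : Real.exp (-(r₂ * ((N + 1 : ℕ) : ℝ))) ≤ Real.exp (-(K⁻¹ * ((N : ℝ) + 1))) := by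
      rw [Real.exp_le_exp]; push_cast; nlinarith
    have h3 : 0 < Real.exp (-(K⁻¹ * ((N : ℝ) + 1))) := Real.exp_pos _
    nlinarith
  · push Not at hN
    refine (hp1 N).trans ?_
    rw [← ENNReal.ofReal_one]
    refine ENNReal.ofReal_le_ofReal ?_
    -- `n ≤ N₀ < K` so `e^{-n/K} ≥ e^{-1}` and `K e^{-1} ≥ 3/e > 1`
    have hnK : K⁻¹ * ((N : ℝ) + 1) ≤ 1 := by
      rw [inv_mul_le_iff₀ hK0, hK]
      have : (N : ℝ) + 1 ≤ N₀ := by exact_mod_cast hN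
      linarith
    have h1 : Real.exp (-1) ≤ Real.exp (-(K⁻¹ * ((N : ℝ) + 1))) := Real.exp_le_exp.2 (by linarith)
    have h2 : (1 : ℝ) ≤ 3 * Real.exp (-1) := by
      rw [Real.exp_neg, le_mul_inv_iff₀ (Real.exp_pos 1)]
      linarith [Real.exp_one_lt_d9]
    have h3 : 0 < Real.exp (-1) := Real.exp_pos _
    nlinarith

/-- **Exponential concentration of the density field, uniformly at low density.** For a density
profile `P` and `0 < σ < 1/2` with `e · 2M · v₁ · σ³ ≤ 1/32`, every continuous `χ` and `δ > 0`
admit `K > 0` with `ν_N {δ < |(N+1)⁻¹ ∑ χ(xᵢ) - Ilim P σ χ|} ≤ K e^{-(N+1)/K}` for ALL `N`, where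
`ν_N = Ξ⁻¹ μ_P^{⊗(N+1)}|_H` is the canonical law of `N + 1` hard spheres of diameter
`σ(N+1)^{-1/3}` on `𝕋³`. -/
theorem density_concentration (hσ : 0 < σ) (hσ2 : σ < 1 / 2)
    (hsmall : Real.exp 1 * (2 * P.M * v₁ * σ ^ 3) ≤ 1 / 32) {χ : T3 → ℝ} (hχ : Continuous χ)
    {δ : ℝ} (hδ : 0 < δ) :
    ∃ K : ℝ, 0 < K ∧ ∀ N : ℕ,
      (ENNReal.ofReal (Xi P (hsDiameter σ N) (N + 1) (N + 1))⁻¹ •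
          (Measure.pi fun _ : Fin (N + 1) => P.μ).restrict (hardCoreSet (Ov (hsDiameter σ N)) univ))
        {x | δ < |((N + 1 : ℕ) : ℝ)⁻¹ * ∑ i, χ (x i) - Ilim P σ χ|} ≤
      ENNReal.ofReal (K * Real.exp (-(K⁻¹ * ((N : ℝ) + 1)))) := by
  obtain ⟨C', hC'0, hχC'⟩ := exists_forall_abs_le_of_continuous hχ
  set C := C' + 1 with hC
  have hC0 : 0 < C := by rw [hC]; linarith
  have hχC : ∀ y, |χ y| ≤ C := fun y => (hχC' y).trans (by rw [hC]; linarith)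
  have hχn : Continuous fun y => -χ y := hχ.neg
  have hχnC : ∀ y, |(-χ y)| ≤ C := fun y => by rw [abs_neg]; exact hχC y
  obtain ⟨r₁, hr₁, N₁, h₁⟩ := eventually_upperTail_le hσ hσ2 hsmall hχ hC0 hχC hδ
  obtain ⟨r₂, hr₂, N₂, h₂⟩ := eventually_upperTail_le hσ hσ2 hsmall hχn hC0 hχnC hδ
  rw [Ilim_neg] at h₂
  have hM := P.M_pos
  have hlam : ovDensity P σ < 1 := by
    have he : 1 ≤ Real.exp 1 := by have := Real.add_one_le_exp (1 : ℝ); linarith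
    have hv := v₁_pos.le
    have h1 : ovDensity P σ ≤ Real.exp 1 * (2 * P.M * v₁ * σ ^ 3) := by
      rw [ovDensity]
      have h0 : 0 ≤ P.M * v₁ * σ ^ 3 := by have := pow_pos hσ 3; positivity
      nlinarith
    linarith
  refine exists_const_of_eventually (fun N => canonical_le_one hσ hσ2 hlam N _) hr₁ hr₂ (N₀ := max N₁ N₂)
    fun N hN => ?_
  have hN₁ : N₁ ≤ N := le_of_max_le_left hN
  have hN₂ : N₂ ≤ N := le_of_max_le_right hN
  refine le_trans (measure_mono fun x hx => ?_) ((measure_union_le _ _).trans (add_le_add (h₁ N hN₁) (h₂ N hN₂)))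
  -- the deviation event is contained in the union of the two tail events
  simp only [Set.mem_setOf_eq, Set.mem_union] at hx ⊢
  have hn : (0 : ℝ) < ((N + 1 : ℕ) : ℝ) := by positivity
  set S := ∑ i, χ (x i) with hS
  have hS' : ∑ i, -χ (x i) = -S := by rw [hS, sum_neg_distrib]
  rw [hS']
  rcases lt_abs.1 hx with h | h
  · left
    have : Ilim P σ χ + δ < ((N + 1 : ℕ) : ℝ)⁻¹ * S := by linarith
    rw [lt_inv_mul_iff₀ hn] at this
    linarith
  · right
    have : ((N + 1 : ℕ) : ℝ)⁻¹ * S < Ilim P σ χ - δ := by linarith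
    rw [inv_mul_lt_iff₀ hn] at this
    linarith

end TwoSided

end UniformLGC

end Summit.AtomisticToContinuum.HydrodynamicLimit.Theorems

end
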